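import Literature.IUT.HodgeTheaters.ThetaPMEllNFHTIsoNonVacuity
import Literature.IUT.HodgeTheaters.ThetaNFHodgeTheatersHomNonVacuity
import Literature.IUT.HodgeTheaters.KitIsoKitOfDatum
import HarnessLib

/-!
# [IUTchI] Rmk 6.12.2 (ii) — identity isomorphisms of Θ^{±ell}NF-Hodge theaters over the GENUINE ΘNF-side kit

Proof-only ADDITIVE companion of `ThetaPMEllNFHTIsoNonVacuity.lean` (NV-L5 row `PMBaseKit.S5Local.ThetaPMEllNFHT.Iso`;
post-freeze additive, not a cone member; 0 definitions). Node ids: IUTchI:Rmk6.12.2(ii), IUTchI:Def6.13(i)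
(non-vacuity evidence about OUR typed structures only).

`ThetaPMEllNFHTIsoNonVacuity.lean` proves that a Θ^{±ell}NF-Hodge theater `X` has an identity isomorphism for ANY
gluing kit `IK : PMBaseKit.IsoKit S K` GIVEN a ΘNF-side self-isomorphism `φ : IK.thIso X.thNF X.thNF` inducing the
identity on the index set `J` («`IsoKit` has no refl»). Here that datum is DISCHARGED over abc-iut-L5-t3's genuine
kit `BaseThetaDatum.S5Local.ofDatum fc nl` / `S5Local.IsoKit.ofDatum fc nl` ([IUTchI] Def 5.5 (iii): isomorphisms of
ΘNF-Hodge theaters ARE `ThetaNFHodgeTheater.Hom`), from exactly the two printed rigidity inputs BY NAME: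
Cor 5.3 (i) (existence half: `S.baseGIso` surjective at `X.thNF.globF`) and Cor 5.3 (ii) (`FK.IsomFtoDBijective`).

* `ThetaNFHodgeTheater.Hom.theta_under_ι_apply` — every endomorphism of a ΘNF-Hodge theater induces the identity on
  `J` (rigidity of labels, Prop 4.7 (i) / 4.8 (ii): `DThetaBridge.Hom.χ_comp` + injectivity of `†χ`); unconditional.
* `nonempty_thetaPMEllNFHT_iso_self_ofDatum` — identity isomorphisms of Θ^{±ell}NF-Hodge theaters over the genuine
  kit exist given Cor 5.3 (i)/(ii) by name (abc-iut-L5-t8's `ThetaNFHodgeTheater.Hom.nonempty_of_baseGIso_surjective`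
  ⧺ the first theorem ⧺ `ThetaPMEllNFHT.Iso.nonempty_of_isomFtoDBijective`).

Source: [IUTchI] = Mochizuki, *Inter-universal Teichmüller Theory I*, kurims final manuscript (May 2020),
Rmk 6.12.2 (ii) p. 174, Def 6.13 (i) p. 182, Prop 4.8 (ii) p. 115, Cor 5.3 (i)(ii) p. 143. Honest framing: nothing here
asserts that abc is proved or refuted; instantiated ≠ endorsed; no side taken on [IUTchIII] Cor 3.12.
Drafted by abc-iut-L5-t14 (gen 5) as a companion suggestion (HOME/staging/L5/L5-t14g5/, RULINGS #32 (1)); filed by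
abc-iut-L5-d2 (gen 6), author of the parent module.
-/

namespace Literature.IUT.HodgeTheaters

open CategoryTheory

universe u

namespace BaseThetaDatum

namespace S5Local

/-- **Rigidity of labels** (Prop. 4.7 (i) / 4.8 (ii)): an endomorphism of a ΘNF-Hodge theater induces the identity on its
index set `J` (its Θ-bridge component respects `†χ : J ⥲ 𝔽_l^⋇`, `DThetaBridge.Hom.χ_comp`).
([IUTchI] Prop 4.8 (ii) p. 115) [claim: Mochizuki2012, status: disputed] -/
theorem ThetaNFHodgeTheater.Hom.theta_under_ι_apply {𝔡 : BaseThetaDatum.{u}} {S : S5Local 𝔡}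
    {H : ThetaNFHodgeTheater S} (φ : ThetaNFHodgeTheater.Hom H H) (j : H.J) : φ.theta.under.ι j = j :=
  H.toThetaBridge.under.χ.injective (φ.theta.under.χ_comp j)

variable {𝔡 : BaseThetaDatum.{u+1}} {K : PMBaseKit.{u+1} 𝔡.l} {S : S5Local 𝔡} {c : 𝔡.KitCore K} {M : K.MultKit}
  {FK : K.FKit M}

/-- **Rmk 6.12.2 (ii) over the GENUINE ΘNF-side kit of Def. 5.5** (abc-iut-L5-t3's `S5Local.ofDatum` / `IsoKit.ofDatum`,
where isomorphisms of ΘNF-Hodge theaters ARE Def 5.5 (iii) morphisms): every Θ^{±ell}NF-Hodge theater has an identity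
isomorphism GIVEN exactly the two printed rigidity inputs by name — Cor. 5.3 (i) (existence half: `S.baseGIso`
surjective on `ℱ^⊚`-isomorphs, `hS`) and Cor. 5.3 (ii) (`FK.IsomFtoDBijective`, `hF`): the ΘNF-side self-isomorphism
that abc-iut-L5-d2's `Iso.nonempty_of_isomFtoDBijective` leaves as a datum is an endomorphism of the Def 5.5 (iii)
theater (abc-iut-L5-t8's `ThetaNFHodgeTheater.Hom.nonempty_of_baseGIso_surjective`), and it induces the identity on
`J` by rigidity of the labels. Model-relative (no toy). ([IUTchI] Rmk 6.12.2 (ii) p. 174) [claim: Mochizuki2012, status: disputed] -/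
theorem nonempty_thetaPMEllNFHT_iso_self_ofDatum (fc : S.FKitCore c FK) (nl : c.NFLink) {hl : Odd 𝔡.l}
    (X : (ofDatum fc nl).ThetaPMEllNFHT hl)
    (hS : Function.Surjective
      (S.baseGIso : (X.thNF.globF ≅ X.thNF.globF) → (S.baseG X.thNF.globF ≅ S.baseG X.thNF.globF)))
    (hF : FK.IsomFtoDBijective) :
    Nonempty (PMBaseKit.S5Local.ThetaPMEllNFHT.Iso (IsoKit.ofDatum fc nl) X X) := by
  obtain ⟨φ⟩ := ThetaNFHodgeTheater.Hom.nonempty_of_baseGIso_surjective X.thNF X.thNF hS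
  exact PMBaseKit.S5Local.ThetaPMEllNFHT.Iso.nonempty_of_isomFtoDBijective _ hF X φ
    fun j => ThetaNFHodgeTheater.Hom.theta_under_ι_apply φ j

end S5Local

end BaseThetaDatum

end Literature.IUT.HodgeTheaters
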